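import Mathlib.ModelTheory.Order
import Literature.ModelTheory.ExponentialFields.RealClosedFieldTheory
import HarnessLib

/-!
# Abstract models of the theories of ordered fields and of real closed fields

Support file for the model theory of `Literature.ModelTheory.ExponentialFields.Theory.orderedField`
and `Literature.ModelTheory.ExponentialFields.Theory.RCF` (`RealClosedFieldTheory.lean`, C8). That
file relates the two theories to Mathlib's algebraic classes only for types *already* carrying
`+, *, -, 0, 1, ≤` (the global structure `Language.orderedRing.instStructure` of `Languages.lean`):
`model_orderedField`, `model_RCF_iff_isRealClosed`. Statements about the *consequences* of these
theories (`Theory.RCF ⊨ᵇ φ`: completeness, decidability, quantifier elimination — Tarski 1951)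
quantify over *all* bundled models `M : Theory.RCF.ModelType`, i.e. over arbitrary
`Language.orderedRing`-structures satisfying the axioms, and need the converse construction,
which is the content of this file (Marker 2002, §1.2, Example 1.2.8 and §3.3: "the models of
`RCF` are exactly the real closed ordered fields"):

* `OrderedFieldModel.Dom M` — a type synonym for the universe of an `Language.orderedRing`-structure
  `M`, equipped with `+, *, -, 0, 1` *read off* the interpretation of the symbols (so that the
  global structure `Language.orderedRing.instStructure` on `Dom M` is the given structure:
  `OrderedFieldModel.structure_eq`, whence `Dom M ⊨ σ ↔ M ⊨ σ`, `OrderedFieldModel.realize_iff`);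
* for `M ⊨ Theory.orderedField`: `Field (Dom M)` (Mathlib's field axioms `Theory.field`, pulled
  back along `ringHomOrderedRing`, through a `Ring.CompatibleRing (Dom M)` instance whose structure
  is the reduct), `LinearOrder (Dom M)` (Mathlib's `Language.linearOrderOfModels`),
  `IsStrictOrderedRing (Dom M)` (from `addMonotoneSentence`, `mulPosSentence`);
* for `M ⊨ Theory.RCF`: `OrderedFieldModel.isRealClosed : IsRealClosed (Dom M)`
  (`isRealClosed_of_model_RCF` of C8, now applicable).

The type synonym keeps the notation-class instances (and the structure they generate) apart from
the given structure on `M`, exactly as `OrderDual`/`Additive` do; compare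
`Literature.ModelTheory.ExponentialFields.OEFModel` (`OrderedExpFieldModels.lean`), which performs
the same construction for the finite theory `OEF` of ordered exponential fields directly on bundled
models (possible there because `Language.orderedExpRing.instStructure` needs an `ExponentialRing`
instance, which is never put on a model; for `Language.orderedRing` the global structure only
needs the notation classes, hence the synonym).

## References

* D. Marker, *Model Theory: An Introduction*, Springer GTM 217 (2002), Example 1.2.8, §3.3.
* A. Tarski, *A decision method for elementary algebra and geometry*, 2nd ed., Univ. of
  California Press (1951) (notes: the decision method applies to every real closed field).
* Mathlib, `Mathlib/ModelTheory/Algebra/Field/Basic.lean` (`fieldOfModelField`, the same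
  construction for `Language.ring`), `Mathlib/ModelTheory/Order.lean` (`linearOrderOfModels`).
-/

noncomputable section

open FirstOrder FirstOrder.Language FirstOrder.Language.Structure

universe w

namespace Literature.ModelTheory.ExponentialFields

namespace OrderedFieldModel

/-- The universe of a `Language.orderedRing`-structure `M`, as a type synonym on which `+, *, -, 0,
1, ≤` are *defined* as the interpretations of the corresponding symbols (Marker 2002, §1.2: the
structure `(M; +^M, *^M, -^M, 0^M, 1^M, ≤^M)`). [folklore] -/
def Dom (M : Type w) [Language.orderedRing.Structure M] : Type w := M

variable {M : Type w} [instM : Language.orderedRing.Structure M]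

/-- `+` on `Dom M`: the interpretation of the symbol `+`. [folklore] -/
instance : Add (Dom M) :=
  ⟨fun a b => (funMap (L := Language.orderedRing) (M := M) ringFunc.add ![a, b] : M)⟩

/-- `*` on `Dom M`: the interpretation of the symbol `*`. [folklore] -/
instance : Mul (Dom M) :=
  ⟨fun a b => (funMap (L := Language.orderedRing) (M := M) ringFunc.mul ![a, b] : M)⟩

/-- `-` on `Dom M`: the interpretation of the symbol `-`. [folklore] -/
instance : Neg (Dom M) :=
  ⟨fun a => (funMap (L := Language.orderedRing) (M := M) ringFunc.neg ![a] : M)⟩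

/-- `0` of `Dom M`: the interpretation of the symbol `0`. [folklore] -/
instance : Zero (Dom M) :=
  ⟨(funMap (L := Language.orderedRing) (M := M) ringFunc.zero ![] : M)⟩

/-- `1` of `Dom M`: the interpretation of the symbol `1`. [folklore] -/
instance : One (Dom M) :=
  ⟨(funMap (L := Language.orderedRing) (M := M) ringFunc.one ![] : M)⟩

/-- `Dom M` is nonempty when `M` is. [folklore] -/
instance [h : Nonempty M] : Nonempty (Dom M) := h

/-- The `Language.ring`-structure on `Dom M` obtained by forgetting `≤` (the reduct along
`ringHomOrderedRing`) is compatible, in Mathlib's sense `Ring.CompatibleRing`, with the operations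
`+, *, -, 0, 1` of `Dom M` (which were read off it). [folklore] -/
instance instCompatibleRing : Ring.CompatibleRing (Dom M) where
  toStructure := (ringHomOrderedRing.reduct M : Language.ring.Structure M)
  funMap_add v := by
    show funMap (L := Language.orderedRing) (M := M) ringFunc.add v =
      funMap (L := Language.orderedRing) (M := M) ringFunc.add ![v 0, v 1]
    exact congrArg _ (by ext i; fin_cases i <;> rfl)
  funMap_mul v := by
    show funMap (L := Language.orderedRing) (M := M) ringFunc.mul v =
      funMap (L := Language.orderedRing) (M := M) ringFunc.mul ![v 0, v 1]
    exact congrArg _ (by ext i; fin_cases i <;> rfl)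
  funMap_neg v := by
    show funMap (L := Language.orderedRing) (M := M) ringFunc.neg v =
      funMap (L := Language.orderedRing) (M := M) ringFunc.neg ![v 0]
    exact congrArg _ (by ext i; fin_cases i; rfl)
  funMap_zero v := by
    show funMap (L := Language.orderedRing) (M := M) ringFunc.zero v =
      funMap (L := Language.orderedRing) (M := M) ringFunc.zero ![]
    exact congrArg _ (Subsingleton.elim _ _)
  funMap_one v := by
    show funMap (L := Language.orderedRing) (M := M) ringFunc.one v =
      funMap (L := Language.orderedRing) (M := M) ringFunc.one ![]
    exact congrArg _ (Subsingleton.elim _ _)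

/-- The reduct `Language.ring`-structure of `Dom M` is expanded by the given
`Language.orderedRing`-structure of `M` (Mathlib's `LHom.isExpansionOn_reduct`). [folklore] -/
instance instIsExpansionOnReduct :
    @LHom.IsExpansionOn _ _ ringHomOrderedRing (Dom M) _ (instM) :=
  LHom.isExpansionOn_reduct ringHomOrderedRing M

/-- `ringHomOrderedRing.onTheory Theory.field ⊆ Theory.orderedField`. [folklore] -/
theorem onTheory_field_subset_orderedField :
    ringHomOrderedRing.onTheory Language.Theory.field ⊆ Theory.orderedField :=
  Set.subset_union_left.trans Set.subset_union_left

/-- `Language.orderedRing.linearOrderTheory ⊆ Theory.orderedField`. [folklore] -/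
theorem linearOrderTheory_subset_orderedField :
    Language.orderedRing.linearOrderTheory ⊆ Theory.orderedField :=
  Set.subset_union_right.trans Set.subset_union_left

section OrderedField

variable [hM : M ⊨ Theory.orderedField]

/-- A model of `Theory.orderedField` is, after forgetting `≤`, a model of Mathlib's theory of
fields `Theory.field` (the field axioms of `Theory.orderedField` are `Theory.field` transported
along `ringHomOrderedRing`; Mathlib's `LHom.onTheory_model`). [folklore] -/
instance model_field : Language.Theory.field.Model (Dom M) := by
  have h : M ⊨ ringHomOrderedRing.onTheory Language.Theory.field :=
    Language.Theory.Model.mono hM onTheory_field_subset_orderedField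
  letI : Language.ring.Structure M := ringHomOrderedRing.reduct M
  have h' : M ⊨ Language.Theory.field := (LHom.onTheory_model ringHomOrderedRing _).1 h
  exact h'

open FirstOrder.Field in
/-- **A model of the theory of ordered fields is a field** (Marker 2002, Example 1.2.8): the field
structure on `Dom M` with the operations read off the structure, by Mathlib's
`Field.ofMinimalAxioms` on the field axioms `FieldAxiom.toProp_of_model` (the construction of
Mathlib's `FirstOrder.Field.fieldOfModelField`, run for the notation instances of `Dom M`).
[folklore] -/
instance instField : Field (Dom M) :=
  letI : DecidableEq (Dom M) := Classical.decEq _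
  have exists_inv : ∀ x : Dom M, x ≠ 0 → ∃ y : Dom M, x * y = 1 :=
    FieldAxiom.existsInv.toProp_of_model
  letI : Inv (Dom M) :=
    ⟨fun x => if hx0 : x = 0 then 0 else Classical.choose (exists_inv x hx0)⟩
  Field.ofMinimalAxioms (Dom M)
    FieldAxiom.addAssoc.toProp_of_model
    FieldAxiom.zeroAdd.toProp_of_model
    FieldAxiom.negAddCancel.toProp_of_model
    FieldAxiom.mulAssoc.toProp_of_model
    FieldAxiom.mulComm.toProp_of_model
    FieldAxiom.oneMul.toProp_of_model
    (fun x hx0 => show x * (dite _ _ _) = _ from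
        (dif_neg hx0).symm ▸ Classical.choose_spec (exists_inv x hx0))
    (dif_pos rfl)
    FieldAxiom.leftDistrib.toProp_of_model
    FieldAxiom.existsPairNE.toProp_of_model

/-- **A model of the theory of ordered fields is linearly ordered** by the interpretation of `≤`
(Mathlib's `Language.linearOrderOfModels`, for the axioms `Language.linearOrderTheory ⊆
Theory.orderedField`). [folklore] -/
instance instLinearOrder : LinearOrder (Dom M) :=
  @Language.linearOrderOfModels Language.orderedRing (Dom M) _ (instM)
    (@Language.Theory.Model.mono _ (Dom M) (instM) _ _ hM
      linearOrderTheory_subset_orderedField)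
    (Classical.decRel _)

/-- `a ≤ b` in `Dom M` is the interpretation of `≤` (by definition). [folklore] -/
theorem le_iff (a b : Dom M) :
    a ≤ b ↔ RelMap (L := Language.orderedRing) (M := M) Language.orderRel.le ![a, b] :=
  Iff.rfl

/-- **The structure generated by the operations of `Dom M` is the given structure**: the global
`Language.orderedRing`-structure of `Languages.lean` on the type `Dom M` (built from its
`+, *, -, 0, 1, ≤`) coincides with the structure of `M`. [folklore] -/
theorem structure_eq :
    (Language.orderedRing.instStructure : Language.orderedRing.Structure (Dom M)) =
      (instM : Language.orderedRing.Structure M) := by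
  refine Language.Structure.ext ?_ ?_
  · funext n f v
    cases f
    · show funMap (L := Language.orderedRing) (M := M) ringFunc.add ![v 0, v 1] =
        funMap (L := Language.orderedRing) (M := M) ringFunc.add v
      exact congrArg _ (by ext i; fin_cases i <;> rfl)
    · show funMap (L := Language.orderedRing) (M := M) ringFunc.mul ![v 0, v 1] =
        funMap (L := Language.orderedRing) (M := M) ringFunc.mul v
      exact congrArg _ (by ext i; fin_cases i <;> rfl)
    · show funMap (L := Language.orderedRing) (M := M) ringFunc.neg ![v 0] =
        funMap (L := Language.orderedRing) (M := M) ringFunc.neg v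
      exact congrArg _ (by ext i; fin_cases i; rfl)
    · show funMap (L := Language.orderedRing) (M := M) ringFunc.zero ![] =
        funMap (L := Language.orderedRing) (M := M) ringFunc.zero v
      exact congrArg _ (Subsingleton.elim _ _)
    · show funMap (L := Language.orderedRing) (M := M) ringFunc.one ![] =
        funMap (L := Language.orderedRing) (M := M) ringFunc.one v
      exact congrArg _ (Subsingleton.elim _ _)
  · funext n r v
    cases r
    show (v 0 ≤ v 1) = RelMap (L := Language.orderedRing) (M := M) Language.orderRel.le v
    have hv : v = ![v 0, v 1] := by ext i; fin_cases i <;> rfl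
    conv_rhs => rw [hv]
    rfl

/-- Truth of sentences in `Dom M` (for the structure generated by its operations) is truth in
`M`. [folklore] -/
theorem realize_iff (σ : Language.orderedRing.Sentence) : Dom M ⊨ σ ↔ M ⊨ σ :=
  iff_of_eq (congrArg
    (fun S : Language.orderedRing.Structure M => @Sentence.Realize Language.orderedRing M S σ)
    (structure_eq (M := M)))

/-- `Dom M` (for the structure generated by its operations) is a model of a theory iff `M` is.
[folklore] -/
theorem model_iff (T : Language.orderedRing.Theory) : Dom M ⊨ T ↔ M ⊨ T := by
  simp only [Language.Theory.model_iff, realize_iff]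

/-- `Dom M` is a model of `Theory.orderedField` (for the structure generated by its operations).
[folklore] -/
instance model_orderedField_dom : Dom M ⊨ Theory.orderedField :=
  (model_iff _).2 hM

/-- Translation invariance of `≤` in a model of `Theory.orderedField` (the axiom
`addMonotoneSentence`). [folklore] -/
theorem add_le_add_left' {a b : Dom M} (h : a ≤ b) (c : Dom M) : c + a ≤ c + b := by
  have hs : Dom M ⊨ addMonotoneSentence :=
    Language.Theory.realize_sentence_of_mem Theory.orderedField
      (Set.mem_union_right _ (Set.mem_insert _ _))
  exact realize_addMonotoneSentence.1 hs a b c h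

/-- Products of non-negative elements are non-negative in a model of `Theory.orderedField` (the
axiom `mulPosSentence`). [folklore] -/
theorem mul_nonneg' {a b : Dom M} (ha : 0 ≤ a) (hb : 0 ≤ b) : 0 ≤ a * b := by
  have hs : Dom M ⊨ mulPosSentence :=
    Language.Theory.realize_sentence_of_mem Theory.orderedField
      (Set.mem_union_right _ (Set.mem_insert_of_mem _ (Set.mem_singleton _)))
  exact realize_mulPosSentence.1 hs a b ha hb

/-- Addition is monotone in a model of `Theory.orderedField`. [folklore] -/
instance instIsOrderedAddMonoid : IsOrderedAddMonoid (Dom M) where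
  add_le_add_left a b hab c := by
    rw [add_comm a c, add_comm b c]
    exact add_le_add_left' hab c

/-- `0 ≤ 1` in a model of `Theory.orderedField` (if `1 < 0` then `0 ≤ -1`, so
`0 ≤ (-1) * (-1) = 1`). [folklore] -/
theorem zero_le_one' : (0 : Dom M) ≤ 1 := by
  by_contra h
  have h1 : (1 : Dom M) ≤ 0 := (not_le.1 h).le
  have h2 : (0 : Dom M) ≤ -1 := by simpa using add_le_add_left' h1 (-1)
  have h3 : (0 : Dom M) ≤ (-1) * (-1) := mul_nonneg' h2 h2
  exact h (by simpa using h3)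

/-- **A model of the theory of ordered fields is a (strictly) ordered field**
(Bochnak–Coste–Roy 1998, Def. 1.1.1; Marker 2002, Example 1.2.8). [folklore] -/
instance instIsStrictOrderedRing : IsStrictOrderedRing (Dom M) :=
  haveI : ZeroLEOneClass (Dom M) := ⟨zero_le_one'⟩
  IsStrictOrderedRing.of_mul_pos fun _ _ ha hb =>
    lt_of_le_of_ne (mul_nonneg' ha.le hb.le) (mul_ne_zero ha.ne' hb.ne').symm

end OrderedField

end OrderedFieldModel

/-- A model of `Theory.RCF` is a model of `Theory.orderedField` (`Theory.orderedField ⊆ Theory.RCF`).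
[folklore] -/
instance model_orderedField_of_model_RCF {M : Type w} [Language.orderedRing.Structure M]
    [hM : M ⊨ Theory.RCF] : M ⊨ Theory.orderedField :=
  Language.Theory.Model.mono hM Theory.orderedField_subset_RCF

namespace OrderedFieldModel

variable {M : Type w} [instM : Language.orderedRing.Structure M]

/-- `Dom M` is a model of `Theory.RCF` (for the structure generated by its operations) when `M`
is. [folklore] -/
instance model_RCF_dom [hM : M ⊨ Theory.RCF] : Dom M ⊨ Theory.RCF :=
  (model_iff _).2 hM

/-- **Every model of `RCF` is a real closed field** (Tarski 1951; Marker 2002, §3.3): for an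
arbitrary `Language.orderedRing`-structure `M ⊨ Theory.RCF`, the ordered field `Dom M` is real
closed in Mathlib's sense `IsRealClosed` (`isRealClosed_of_model_RCF` of
`RealClosedFieldTheory.lean`, applied to `Dom M`). [cite: Marker2002, §3.3] -/
theorem isRealClosed [M ⊨ Theory.RCF] : IsRealClosed (Dom M) :=
  isRealClosed_of_model_RCF (Dom M)

end OrderedFieldModel

end Literature.ModelTheory.ExponentialFields
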